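import Mathlib
import Summits.ValiantsHypothesis.ValiantsHypothesis.Theorems.FifoMatchingNNDivisionHardPadWordNarrowBand
import Summits.ValiantsHypothesis.ValiantsHypothesis.Theorems.FifoMatchingNNDivisionHardBandLocal
import HarnessLib

/-!
# Route FifoMatching — crux `NNDivisionHard` (stmt-ValiantsHypothesis-21181): certificates are NARROW-SCALE-COVERING

Sharpening of `…BandLocal.lean` by the narrow-band support of `…PadWordNarrowBand.lean` (the generic law and the
arithmetic engines are imported from `…BandLocal.lean`; the gate's dedup rule forbids re-homing them in a route-independent copy,
so this module sits in the cone of `Theses/FifoMatching.lean` like `…BandLocal.lean` itself).  For an admissible parameter `u`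
(`T(u) = 192u⁵ + 176u⁴ + 29u³ + 24u + 4 ≤ n`, `20 n (log₂ n + 1) ≤ u⁶`) write `λ(u) = 8u⁴ + 3u³` (the padding length),
`B(u) = [8u⁴ + 2u³ + 1, 16u⁴ + 8u³ − 1]` (the wide band) and `B°(u) = [16u⁴ + 4u³ + 1, 16u⁴ + 8u³ − 1]` (the NARROW band,
relative width `< 1/(4u)`; the `B°(u)` are pairwise disjoint for distinct `u`).  A variable `x_(i,j)` is POSSIBLE at scale `u` if
`j − i ∈ B(u)` and, when it is interior (`λ(u) ≤ i`, `j < 2n − λ(u)`), moreover `j − i ∈ B°(u)`.  The thick-queue measure with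
parameter `u` lives on matchings all of whose arcs are possible at scale `u`, so by the generic local law:

* ★★ `narrowAvoiding_lower_bound` — for every admissible `u` and every `h ≠ 0` with NO variable possible at scale `u`:
  `2^u ≤ 16 n (n+1)² (L₊(NN_n · h) + 1)`;
* ★★ `narrowAvoiding_not_certificate_qp` (and the disjunctive reading `narrowAvoiding_not_certificate_qp'`) — for every `c`,
  eventually in `n`: such `h` satisfy the crux inequality `2^((log₂ n + c)^c) < L₊(NN_n · h) + L₊(h)`.  READING: a quasi-polynomial
  certificate cofactor has, for EVERY admissible `u`, a variable possible at scale `u`; in particular an INTERIOR cofactor (all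
  variables `x_(i,j)` with `λ(u_max) ≤ i`, `j < 2n − λ(u_max)`) has an arc length in every narrow band `B°(u)` — pairwise disjoint
  — hence at least as many distinct arc lengths as there are admissible `u` (`≈ (n/192)^{1/5} − (20 n (log₂ n + 1))^{1/6}`);
* ★ BY NAME `nnDivisionHard_iff_narrowScaleCoveringTier` — `NNDivisionHard` ⟺ the crux inequality for the cofactors having,
  for every admissible `u`, a variable possible at scale `u`.

HONEST FRAMING: a structural constraint on certificates for ONE candidate family; stmt-21181 stays OPEN (residual: grand
residual ∧ block-dense ∧ prefix/adjacent-non-generic ∧ NARROW-SCALE-COVERING); nothing here bears on `NNNotVP` or on VP ≠ VNP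
(NOT proved).  No definitions, no named facts.
References: Hrubeš–Yehudayoff 2021 §6 Problem 2 [HrubesYehudayoff2021]; Bürgisser 2000 Rem. 2.7 [Burgisser2000].
-/

noncomputable section

-- Sub = Summit single-conjunct layout: the duplicated namespace component is mandated by the tree.
set_option linter.dupNamespace false
set_option autoImplicit false

namespace Summit.ValiantsHypothesis.ValiantsHypothesis.Theorems.FifoMatching.NNDivisionHard.NarrowBandLocal

open Finset MvPolynomial Literature.Computability.AlgebraicComplexity
open Summit.ValiantsHypothesis.ValiantsHypothesis.Theorems.FifoMatching.NNDivisionHard.BandLocal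
  (local_spreadLaw band_estimate_of_log two_pow_le_of_spreadLaw qp_lt_of_two_pow_le)
open Summit.ValiantsHypothesis.ValiantsHypothesis.Theorems.FifoMatching.NNDivisionHard.PadWordNarrowBand
  (exists_thick_measure_of_le_narrow)
open scoped NNReal BigOperators

variable {n : ℕ}

/-- ★★ **NARROW-BAND-AVOIDING COFACTORS, every admissible scale.**  Let `u` be admissible at `n` (`T(u) ≤ n`,
`20 n (log₂ n + 1) ≤ u⁶`) and let `h ≠ 0` have NO variable `x_(i,j)` possible at scale `u`, i.e. none with
`j − i ∈ [8u⁴ + 2u³ + 1, 16u⁴ + 8u³ − 1]` and (`8u⁴ + 3u³ ≤ i` → `j + 8u⁴ + 3u³ < 2n` → `16u⁴ + 4u³ + 1 ≤ j − i`).  Then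
`2^u ≤ 16 n (n+1)² (L₊(NN_n · h) + 1)`. [cite: HrubesYehudayoff2021, §6 Problem 2] [cite: Burgisser2000, Rem. 2.7] -/
theorem narrowAvoiding_lower_bound {u : ℕ} (hu : 1 ≤ u)
    (hT : 192 * u ^ 5 + 176 * u ^ 4 + 29 * u ^ 3 + 24 * u + 4 ≤ n) (hlog : 20 * n * (Nat.log 2 n + 1) ≤ u ^ 6)
    {h : MvPolynomial (Fin (2 * n) × Fin (2 * n)) ℝ≥0} (hh : h ≠ 0)
    (havoid : ∀ e ∈ h.vars, ¬ ((8 * u ^ 4 + 3 * u ^ 3 ≤ (e.1 : ℕ) →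
        (e.2 : ℕ) + (8 * u ^ 4 + 3 * u ^ 3) < 2 * n → (e.1 : ℕ) + (16 * u ^ 4 + 4 * u ^ 3 + 1) ≤ (e.2 : ℕ)) ∧
      (e.1 : ℕ) + (8 * u ^ 4 + 2 * u ^ 3 + 1) ≤ (e.2 : ℕ) ∧ (e.2 : ℕ) + 1 ≤ (e.1 : ℕ) + (16 * u ^ 4 + 8 * u ^ 3))) :
    2 ^ u ≤ 16 * n * (n + 1) ^ 2 * (complexity (nestFreeMatchingPoly n ℝ≥0 * h) + 1) := by
  classical
  -- the parameters
  set m : ℕ := u ^ 3 with hm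
  set L : ℕ := 8 * m * u + 3 * m with hL
  set K : ℕ := 2 * L + 4 * m + 2 with hK
  set N : ℕ := 2 * n - 2 * L with hN
  have hT' : 12 * K * u + 3 * L + 2 * K ≤ n := by
    have : 12 * K * u + 3 * L + 2 * K = 192 * u ^ 5 + 176 * u ^ 4 + 29 * u ^ 3 + 24 * u + 4 := by
      simp only [hK, hL, hm]; ring
    rw [this]; exact hT
  have hNle : N ≤ 2 * n := by rw [hN]; omega
  have hNpos : 0 < N := by
    have eT : 12 * K * u = 12 * (K * u) := by ring
    rw [eT] at hT'
    rw [hN]; omega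
  have hn3 : 3 ≤ n := by omega
  have hm2 : 20 * n * (Nat.log 2 n + 1) ≤ m ^ 2 := by
    rw [hm, ← pow_mul]; exact hlog
  have hband := band_estimate_of_log hNpos hNle hm2
  -- the narrow-banded measure and the generic local law
  obtain ⟨μ, hμ1, hμS, hμB⟩ := exists_thick_measure_of_le_narrow hu hm hL hK hN hT' hband
  set I : Finset (Fin (2 * n) × Fin (2 * n)) := univ.filter fun e =>
    ¬ ((8 * u ^ 4 + 3 * u ^ 3 ≤ (e.1 : ℕ) →
        (e.2 : ℕ) + (8 * u ^ 4 + 3 * u ^ 3) < 2 * n → (e.1 : ℕ) + (16 * u ^ 4 + 4 * u ^ 3 + 1) ≤ (e.2 : ℕ)) ∧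
      (e.1 : ℕ) + (8 * u ^ 4 + 2 * u ^ 3 + 1) ≤ (e.2 : ℕ) ∧ (e.2 : ℕ) + 1 ≤ (e.1 : ℕ) + (16 * u ^ 4 + 8 * u ^ 3)) with hI
  have hμI : ∀ M ∈ nestFreeMatchings (2 * n), μ M ≠ 0 → ∀ i ∈ openers M, (i, M i) ∉ I := by
    intro M hM hμM i hi
    obtain ⟨⟨hlo, hhi⟩, hmid⟩ := hμB M hM hμM i hi
    rw [hI, mem_filter, not_and, not_not]
    exact fun _ => ⟨hmid, hlo, hhi⟩
  have hloc : ∀ e ∈ h.vars, e ∈ I := by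
    intro e he
    rw [hI, mem_filter]
    exact ⟨mem_univ _, havoid e he⟩
  have hlaw := local_spreadLaw hn3 I μ hμ1 hμI hμS hh hloc
  exact two_pow_le_of_spreadLaw hNle (by exact_mod_cast hlaw)

/-- ★★ **NARROW-BAND-AVOIDING COFACTORS ARE NOT CERTIFICATES.**  For every `c`, eventually in `n`: for every admissible `u`
and every `h ≠ 0` with no variable possible at scale `u` (see `narrowAvoiding_lower_bound`), the crux inequality
`2^((log₂ n + c)^c) < L₊(NN_n · h) + L₊(h)` holds. [cite: HrubesYehudayoff2021, §6 Problem 2] [cite: Burgisser2000, Rem. 2.7] -/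
theorem narrowAvoiding_not_certificate_qp (c : ℕ) : ∃ n₀ : ℕ, ∀ n : ℕ, n₀ ≤ n → ∀ u : ℕ,
    192 * u ^ 5 + 176 * u ^ 4 + 29 * u ^ 3 + 24 * u + 4 ≤ n → 20 * n * (Nat.log 2 n + 1) ≤ u ^ 6 →
    ∀ h : MvPolynomial (Fin (2 * n) × Fin (2 * n)) ℝ≥0, h ≠ 0 →
      (∀ e ∈ h.vars, ¬ ((8 * u ^ 4 + 3 * u ^ 3 ≤ (e.1 : ℕ) →
          (e.2 : ℕ) + (8 * u ^ 4 + 3 * u ^ 3) < 2 * n → (e.1 : ℕ) + (16 * u ^ 4 + 4 * u ^ 3 + 1) ≤ (e.2 : ℕ)) ∧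
        (e.1 : ℕ) + (8 * u ^ 4 + 2 * u ^ 3 + 1) ≤ (e.2 : ℕ) ∧ (e.2 : ℕ) + 1 ≤ (e.1 : ℕ) + (16 * u ^ 4 + 8 * u ^ 3))) →
      2 ^ ((Nat.log 2 n + c) ^ c) < complexity (nestFreeMatchingPoly n ℝ≥0 * h) + complexity h := by
  obtain ⟨n₀, hn₀⟩ := qp_lt_of_two_pow_le c
  refine ⟨n₀, fun n hn u hT hlog h hh havoid => ?_⟩
  have hun : n ≤ u ^ 6 := by
    have : n ≤ 20 * n * (Nat.log 2 n + 1) := by nlinarith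
    exact this.trans hlog
  have h6 : u ^ 6 ≠ 0 := by
    intro h0
    rw [h0] at hun
    omega
  have hu : 1 ≤ u := Nat.pos_of_ne_zero fun h0 => h6 (by rw [h0]; norm_num)
  exact hn₀ n hn u _ _ hun (narrowAvoiding_lower_bound hu hT hlog hh havoid)

/-- ★★ **Disjunctive reading.**  For every `c`, eventually in `n`: for every admissible `u`, every `h ≠ 0` each of whose
variables `x_(i,j)` is SHORT (`j − i ≤ 8u⁴ + 2u³`), or VERY LONG (`j − i ≥ 16u⁴ + 8u³`), or INTERIOR and below the narrow band
(`8u⁴ + 3u³ ≤ i`, `j + 8u⁴ + 3u³ < 2n`, `j − i ≤ 16u⁴ + 4u³`) satisfies `2^((log₂ n + c)^c) < L₊(NN_n · h) + L₊(h)`.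
[cite: HrubesYehudayoff2021, §6 Problem 2] -/
theorem narrowAvoiding_not_certificate_qp' (c : ℕ) : ∃ n₀ : ℕ, ∀ n : ℕ, n₀ ≤ n → ∀ u : ℕ,
    192 * u ^ 5 + 176 * u ^ 4 + 29 * u ^ 3 + 24 * u + 4 ≤ n → 20 * n * (Nat.log 2 n + 1) ≤ u ^ 6 →
    ∀ h : MvPolynomial (Fin (2 * n) × Fin (2 * n)) ℝ≥0, h ≠ 0 →
      (∀ e ∈ h.vars,
        (e.2 : ℕ) < (e.1 : ℕ) + (8 * u ^ 4 + 2 * u ^ 3 + 1) ∨ (e.1 : ℕ) + (16 * u ^ 4 + 8 * u ^ 3) ≤ (e.2 : ℕ) ∨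
        (8 * u ^ 4 + 3 * u ^ 3 ≤ (e.1 : ℕ) ∧ (e.2 : ℕ) + (8 * u ^ 4 + 3 * u ^ 3) < 2 * n ∧
          (e.2 : ℕ) < (e.1 : ℕ) + (16 * u ^ 4 + 4 * u ^ 3 + 1))) →
      2 ^ ((Nat.log 2 n + c) ^ c) < complexity (nestFreeMatchingPoly n ℝ≥0 * h) + complexity h := by
  obtain ⟨n₀, hn₀⟩ := narrowAvoiding_not_certificate_qp c
  refine ⟨n₀, fun n hn u hT hlog h hh havoid => hn₀ n hn u hT hlog h hh fun e he hQ => ?_⟩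
  obtain ⟨h3, h1, h2⟩ := hQ
  rcases havoid e he with ha | ha | ⟨hb1, hb2, hb3⟩
  · omega
  · omega
  · have := h3 hb1 hb2
    omega

/-! ### By name -/

/-- ★ **BY NAME: `NNDivisionHard` ⟺ its NARROW-SCALE-COVERING tier.**  The crux (stmt-ValiantsHypothesis-21181) is equivalent
to the same inequality for the cofactors `h` which, for EVERY admissible `u` (`T(u) ≤ n`, `20 n (log₂ n + 1) ≤ u⁶`), have a
variable `x_(i,j)` possible at scale `u`: `j − i ∈ [8u⁴ + 2u³ + 1, 16u⁴ + 8u³ − 1]`, and `j − i ≥ 16u⁴ + 4u³ + 1` if the variable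
is interior (`8u⁴ + 3u³ ≤ i`, `j + 8u⁴ + 3u³ < 2n`). [cite: HrubesYehudayoff2021, §6 Problem 2] -/
theorem nnDivisionHard_iff_narrowScaleCoveringTier :
    Summit.ValiantsHypothesis.ValiantsHypothesis.Theses.FifoMatching.NNDivisionHard ↔
    ∀ c : ℕ, ∃ n₀ : ℕ, ∀ n ≥ n₀, ∀ h : MvPolynomial (Fin (2 * n) × Fin (2 * n)) ℝ≥0, h ≠ 0 →
      (∀ u : ℕ, 192 * u ^ 5 + 176 * u ^ 4 + 29 * u ^ 3 + 24 * u + 4 ≤ n → 20 * n * (Nat.log 2 n + 1) ≤ u ^ 6 →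
        ∃ e ∈ h.vars, (8 * u ^ 4 + 3 * u ^ 3 ≤ (e.1 : ℕ) →
            (e.2 : ℕ) + (8 * u ^ 4 + 3 * u ^ 3) < 2 * n → (e.1 : ℕ) + (16 * u ^ 4 + 4 * u ^ 3 + 1) ≤ (e.2 : ℕ)) ∧
          (e.1 : ℕ) + (8 * u ^ 4 + 2 * u ^ 3 + 1) ≤ (e.2 : ℕ) ∧ (e.2 : ℕ) + 1 ≤ (e.1 : ℕ) + (16 * u ^ 4 + 8 * u ^ 3)) →
      2 ^ ((Nat.log 2 n + c) ^ c) < complexity (nestFreeMatchingPoly n ℝ≥0 * h) + complexity h := by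
  constructor
  · intro hN c
    obtain ⟨n₀, hn₀⟩ := hN c
    exact ⟨n₀, fun n hn h hh _ => hn₀ n hn h hh⟩
  · intro H c
    obtain ⟨n₀, hn₀⟩ := H c
    obtain ⟨n₁, hn₁⟩ := narrowAvoiding_not_certificate_qp c
    refine ⟨max n₀ n₁, fun n hn h hh => ?_⟩
    by_contra hq
    apply hq
    apply hn₀ n (le_trans (le_max_left _ _) hn) h hh
    intro u hT hlog
    by_contra hex
    apply hq
    exact hn₁ n (le_trans (le_max_right _ _) hn) u hT hlog h hh fun e he hQ => hex ⟨e, he, hQ⟩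

end Summit.ValiantsHypothesis.ValiantsHypothesis.Theorems.FifoMatching.NNDivisionHard.NarrowBandLocal

end
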